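import Literature.NumberTheory.EllipticCurves.PAdicHeightsProofs
import Literature.NumberTheory.EllipticCurves.PAdicHeightsLogProofs
import Literature.NumberTheory.EllipticCurves.TateCurve.Invariants
import HarnessLib

/-!
# Route `ClassRecordThree`, crux `SchneiderAtThree` (item 19106), BC5 rung `stub_rung_62310y1`: the KERNEL EVALUATOR
# for the rung's one numerical inequality, part 1 — THE Tate parameter to precision `O(3²)`, the scale `C²`, the two
# Iwasawa logarithms, and the assembly `heightFourOneCoord ≠ 0` from one remaining `O(3²)`-bound on `σ²`
# (cell `bsd-stepL`, seat `bsd-stepL-reg3-eng` g2; `--supports stmt-BirchSwinnertonDyer-19106`; plan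
# `run/shared/lean/pub/bsd-stepL/reg3/FORMALISATION-SPEC.md`)

HONEST FRAMING: BSD is not proved by any of this; nothing here closes the crux or the rung leaf; Schneider's conjecture
is asserted nowhere. `Theorems/ClassRecordThreeRung62310y1Admissible.lean` reduced the rung (for `W = ⟨1,1,1,30,−63⟩` =
62310y1, `Q = (809689/240², −909043067/240³)`) to GZK plus the single hypothesis

  HH : ∀ q : ℚ_[3], q ≠ 0 → ‖q‖ < 1 → tateJ q = j(W) → heightFourOneCoord W 3 q x(Q) y(Q) ≠ 0,

the numerical content of the REG3CERT row `62310y1@3` (kit j249075, EVIDENCE). FORMALISATION-SPEC §1: `h ≡ 3 (mod 9)` — so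
`h ≠ 0` — is decided by residues mod `9`/`27`/`81` of a dozen intermediates, all within reach of the tree's FIRST-ORDER
`p`-adic lemmas. This file proves every part not depending on the formal group or the sigma product (theorems only):

* §A `norm_tateParam_sub_six_le`: THE Tate parameter satisfies `‖q − 6‖₃ ≤ 3⁻²` (`q ≡ 2·3 mod 9`), from the tree's
  `norm_tateJ_eq` (`‖j(q)‖ = ‖q‖⁻¹`), `norm_inv_tateJ_sub_le` (`‖1/j(q) − q‖ ≤ ‖q‖²`, ATAEC V.5.1) and
  `1/j(W) = 4174770/2979767519 ≡ 6 (mod 9)`; `j_W` computes `j(W)`.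
* §B (over the tree's `TateCurve/Invariants`: `c₄(E_q) = E₄(q)`, `c₆(E_q) = −E₆(q)`, `‖s_k(q)‖ ≤ ‖q‖`)
  `baseChange_c₄`/`baseChange_c₆` (`c₄(W) = −1439`, `c₆(W) = 65071` in `ℚ₃`) and
  `norm_uniformisationScaleSq_sub_eight_le`: **`‖C² − 8‖ ≤ 3⁻²`** for every `‖q‖ ≤ 3⁻¹` (`C² = uniformisationScaleSq W 3 q`).
* §F `norm_padicLog_57600_le` (`‖log₃(den x(Q))‖ ≤ 3⁻⁴`: `57600 = 3²·6400`, `6400² ≡ 1 mod 3⁴`) and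
  `norm_padicLog_sub_six_le` (`‖y − 144‖ ≤ 3⁻⁴ ⇒ ‖log₃ y − 6‖ ≤ 3⁻²`), both from the tree's `padicLog_of_ne_zero` and the
  first-order tail `norm_padicLogSeries_add_le` of the Iwasawa series.
* §G `heightFourOneCoord_ne_zero_of_norm_bounds`: for ANY `W`, `q` and coordinates with `den x = 57600`, the two bounds
  `‖C² − 8‖ ≤ 3⁻²` (`C² = uniformisationScaleSq W 3 q`) and `‖σ² − 18‖ ≤ 3⁻⁴`
  (`σ² = tateSigmaSq q (coshOfSq (logUnitParamSq W 3 q x y))`) give `heightFourOneCoord W 3 q x y ≠ 0`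
  (`y := C²σ² ≡ 144 mod 3⁴`, `log₃ y ≡ 6`, `log₃(den) ≡ 0`, `h ≡ 3 mod 9`). The first bound is §B; the second is the target
  of part 2 (groups C–E of the SPEC: `σ²` from the cubic expansion of `formalLog`, the `cosh` series and the sigma `tprod`);
  until it lands, HH stays the hypothesis of p421711's rung theorem, now reduced to `σ² ≡ 18 (mod 81)`.

References: [SilvermanATAEC1994] V.3.1(b), V.5.1; [Iwasawa1972PadicL] §4.4; [SteinWuthrich2013] §4.2. -/

open scoped Classical

open WeierstrassCurve Literature.NumberTheory.EllipticCurves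
  Literature.NumberTheory.EllipticCurves.SteinWuthrich2013

namespace Summit.BirchSwinnertonDyer.Rank1Residual.X11b.RegMult.Rung62310y1

/-! ### §0 Norms of explicit `3`-adic numbers (private plumbing) -/

/-- `ord_p n = k` from `p^k ∣ n` and `p^{k+1} ∤ n`. [folklore] -/
private theorem padicValNat_eq_of_dvd_of_not_dvd {p n k : ℕ} [Fact p.Prime] (hn : n ≠ 0) (h1 : p ^ k ∣ n)
    (h2 : ¬ p ^ (k + 1) ∣ n) : padicValNat p n = k := by
  have hle : k ≤ padicValNat p n := (padicValNat_dvd_iff_le hn).mp h1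
  have hlt : ¬ k + 1 ≤ padicValNat p n := fun h => h2 ((padicValNat_dvd_iff_le hn).mpr h); omega

/-- `‖n‖_p = (p^v)⁻¹` for a natural `n ≠ 0` with `ord_p n = v`. [folklore] -/
private theorem norm_natCast_of_padicValNat {p : ℕ} [Fact p.Prime] {n v : ℕ} (hn : n ≠ 0)
    (hv : padicValNat p n = v) : ‖(n : ℚ_[p])‖ = ((p : ℝ) ^ v)⁻¹ := by
  rw [Padic.norm_eq_zpow_neg_valuation (by exact_mod_cast hn), Padic.valuation_natCast, hv, zpow_neg,
    zpow_natCast]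

/-- `‖n/d‖_p = (p^v)⁻¹` for naturals with `ord_p n = v`, `p ∤ d`. [folklore] -/
private theorem norm_natDiv_of_padicValNat {p : ℕ} [Fact p.Prime] {n d v : ℕ} (hn : n ≠ 0) (hd : ¬ p ∣ d)
    (hv : padicValNat p n = v) : ‖((n : ℚ_[p]) / (d : ℚ_[p]))‖ = ((p : ℝ) ^ v)⁻¹ := by
  have hd0 : d ≠ 0 := by rintro rfl; exact hd (dvd_zero p)
  have hd1 : ‖(d : ℚ_[p])‖ = 1 := by
    rw [norm_natCast_of_padicValNat hd0 (padicValNat.eq_zero_of_not_dvd hd), pow_zero, inv_one]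
  rw [norm_div, hd1, div_one, norm_natCast_of_padicValNat hn hv]

/-- Ultrametric inequality for differences. [folklore] -/
private theorem norm_sub_le_max' (a b : ℚ_[3]) : ‖a - b‖ ≤ max ‖a‖ ‖b‖ := by
  rw [sub_eq_add_neg, ← norm_neg b]; exact IsUltrametricDist.norm_add_le_max a (-b)

/-! ### §A THE Tate parameter of 62310y1 at `p = 3` to precision `O(3²)` -/

/-- `j(62310y1) = c₄³/Δ = 2979767519/4174770` (`c₄ = −1439`, `Δ = −4174770 = −2·3·5·31·67²`). [folklore] -/
theorem j_W [h : (⟨1, 1, 1, 30, -63⟩ : WeierstrassCurve ℚ).IsElliptic] :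
    (⟨1, 1, 1, 30, -63⟩ : WeierstrassCurve ℚ).j = 2979767519 / 4174770 := by
  rw [WeierstrassCurve.j, Units.val_inv_eq_inv_val, WeierstrassCurve.coe_Δ']
  norm_num [WeierstrassCurve.c₄, WeierstrassCurve.Δ, WeierstrassCurve.b₂, WeierstrassCurve.b₄,
    WeierstrassCurve.b₆, WeierstrassCurve.b₈]

/-- `‖j(W)‖₃ = 3` (`ord₃ Δ = 1`, `3 ∤ c₄`). [folklore] -/
theorem norm_j_W : ‖((2979767519 / 4174770 : ℚ) : ℚ_[3])‖ = 3 := by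
  have h : ((2979767519 / 4174770 : ℚ) : ℚ_[3]) = (((4174770 : ℕ) : ℚ_[3]) / ((2979767519 : ℕ) : ℚ_[3]))⁻¹ := by
    push_cast; rw [inv_div]
  rw [h, norm_inv, norm_natDiv_of_padicValNat (v := 1) (by norm_num) (by norm_num)
    (padicValNat_eq_of_dvd_of_not_dvd (by norm_num) (by norm_num) (by norm_num))]
  norm_num

/-- `‖1/j(W) − 6‖₃ ≤ 3⁻²`: `1/j(W) = 4174770/2979767519 ≡ 2·3 (mod 9)` (`1/j − 6 = −17874430344/2979767519`,
`9 ∣ 17874430344`). [folklore] -/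
theorem norm_inv_j_W_sub_six_le : ‖(((2979767519 / 4174770 : ℚ) : ℚ_[3]))⁻¹ - 6‖ ≤ 1 / 9 := by
  have h : (((2979767519 / 4174770 : ℚ) : ℚ_[3]))⁻¹ - 6 =
      -(((17874430344 : ℕ) : ℚ_[3]) / ((2979767519 : ℕ) : ℚ_[3])) := by
    push_cast
    rw [inv_div]
    have h0 : ((2979767519 : ℚ_[3])) ≠ 0 := by
      have : ‖((2979767519 : ℕ) : ℚ_[3])‖ = 1 := by
        rw [norm_natCast_of_padicValNat (v := 0) (by norm_num) (padicValNat.eq_zero_of_not_dvd (by norm_num)),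
          pow_zero, inv_one]
      intro hz
      rw [show ((2979767519 : ℕ) : ℚ_[3]) = (2979767519 : ℚ_[3]) by push_cast; rfl, hz, norm_zero] at this
      exact zero_ne_one this
    field_simp
    norm_num
  rw [h, norm_neg, norm_natDiv_of_padicValNat (v := 2) (by norm_num) (by norm_num)
    (padicValNat_eq_of_dvd_of_not_dvd (by norm_num) (by norm_num) (by norm_num))]
  norm_num

/-- **THE Tate parameter of 62310y1 at `3` modulo `9`.** Every `q ∈ ℚ₃` with `‖q‖ < 1` and `j(q) = j(W)` (there is
exactly one, `existsUnique_tateJ_eq_holds`) satisfies `‖q − 6‖₃ ≤ 3⁻²`: ATAEC Lemma V.5.1 in the tree's form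
`‖1/j(q) − q‖ ≤ ‖q‖²` (`norm_inv_tateJ_sub_le`), `‖q‖ = ‖j‖⁻¹ = 3⁻¹` (`norm_tateJ_eq`), `1/j(W) ≡ 6 (mod 9)`.
[cite: SilvermanATAEC1994, Lemma V.5.1] -/
theorem norm_tateParam_sub_six_le {q : ℚ_[3]} (hq1 : ‖q‖ < 1)
    (hj : tateJ q = ((2979767519 / 4174770 : ℚ) : ℚ_[3])) : ‖q - 6‖ ≤ 1 / 9 := by
  have hnq : ‖q‖ = 1 / 3 := by
    have h := norm_tateJ_eq hq1
    rw [hj, norm_j_W] at h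
    have : ‖q‖ = 3⁻¹ := by rw [← inv_inv ‖q‖, ← h]
    rw [this]; norm_num
  have h1 : ‖(tateJ q)⁻¹ - q‖ ≤ 1 / 9 := by
    refine (norm_inv_tateJ_sub_le hq1).trans ?_
    rw [hnq]; norm_num
  have h2 : ‖(tateJ q)⁻¹ - 6‖ ≤ 1 / 9 := by rw [hj]; exact norm_inv_j_W_sub_six_le
  calc ‖q - 6‖ = ‖((tateJ q)⁻¹ - 6) - ((tateJ q)⁻¹ - q)‖ := by ring_nf
    _ ≤ max ‖(tateJ q)⁻¹ - 6‖ ‖(tateJ q)⁻¹ - q‖ := norm_sub_le_max' _ _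
    _ ≤ 1 / 9 := max_le h2 h1

/-! ### §B The uniformisation scale `C²` to precision `O(3²)` -/

/-- `c₄(62310y1) = −1439` read in `ℚ₃`. [folklore] -/
theorem baseChange_c₄ : ((⟨1, 1, 1, 30, -63⟩ : WeierstrassCurve ℚ).baseChange ℚ_[3]).c₄ = -1439 := by
  rw [WeierstrassCurve.baseChange, WeierstrassCurve.map_c₄, eq_ratCast]
  rw [show (⟨1, 1, 1, 30, -63⟩ : WeierstrassCurve ℚ).c₄ = -1439 by
    norm_num [WeierstrassCurve.c₄, WeierstrassCurve.b₂, WeierstrassCurve.b₄]]; push_cast; rfl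

/-- `c₆(62310y1) = 65071` read in `ℚ₃`. [folklore] -/
theorem baseChange_c₆ : ((⟨1, 1, 1, 30, -63⟩ : WeierstrassCurve ℚ).baseChange ℚ_[3]).c₆ = 65071 := by
  rw [WeierstrassCurve.baseChange, WeierstrassCurve.map_c₆, eq_ratCast]
  rw [show (⟨1, 1, 1, 30, -63⟩ : WeierstrassCurve ℚ).c₆ = 65071 by
    norm_num [WeierstrassCurve.c₆, WeierstrassCurve.b₂, WeierstrassCurve.b₄, WeierstrassCurve.b₆]]; push_cast; rfl

/-- **`C² ≡ 8 (mod 9)` for 62310y1 at `3`**: for every `q` with `‖q‖₃ ≤ 3⁻¹`,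
`‖uniformisationScaleSq W 3 q − 8‖ ≤ 3⁻²`. Here `C² = c₆(E_q)·c₄(W)/(c₄(E_q)·c₆(W))` with `c₄(E_q) = 1 + 240 s₃(q)
≡ 1 (mod 9)`, `c₆(E_q) = −1 + 504 s₅(q) ≡ −1 (mod 27)` (`norm_tateS_le`), `c₄(W) = −1439`, `c₆(W) = 65071`, and
`1439/65071 ≡ 8 (mod 9)` (`1439 − 8·65071 = −3⁴·6409`). [cite: SteinWuthrich2013, §4.2] -/
theorem norm_uniformisationScaleSq_sub_eight_le {q : ℚ_[3]} (hq : ‖q‖ ≤ 1 / 3) :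
    ‖uniformisationScaleSq (⟨1, 1, 1, 30, -63⟩ : WeierstrassCurve ℚ) 3 q - 8‖ ≤ 1 / 9 := by
  have hq1 : ‖q‖ ≤ 1 := hq.trans (by norm_num)
  have hs3 : ‖tateS 3 q‖ ≤ 1 / 3 := (TateCurve.norm_tateS_le hq1).trans hq
  have hs5 : ‖tateS 5 q‖ ≤ 1 / 3 := (TateCurve.norm_tateS_le hq1).trans hq
  have h12 : (12 : ℚ_[3]) ≠ 0 := by norm_num
  rw [uniformisationScaleSq, TateCurve.tateCurve_c₄, TateCurve.tateCurve_c₆ h12, baseChange_c₄, baseChange_c₆,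
    TateCurve.tateE4_eq, TateCurve.tateE6]
  set s3 := tateS 3 q
  set s5 := tateS 5 q
  have h65071 : ‖(65071 : ℚ_[3])‖ = 1 := by
    rw [show (65071 : ℚ_[3]) = ((65071 : ℕ) : ℚ_[3]) by norm_cast,
      norm_natCast_of_padicValNat (v := 0) (by norm_num) (padicValNat.eq_zero_of_not_dvd (by norm_num))]
    norm_num
  have h240 : ‖(240 : ℚ_[3])‖ ≤ 1 / 3 := by
    rw [show (240 : ℚ_[3]) = ((240 : ℤ) : ℚ_[3]) by norm_cast]
    exact ((Padic.norm_int_le_pow_iff_dvd (p := 3) 240 1).mpr (by norm_num)).trans (by norm_num)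
  have hD : ‖(1 + 240 * s3) * 65071‖ = 1 := by
    have hsub : ‖(1 + 240 * s3) * 65071 - 65071‖ < ‖(65071 : ℚ_[3])‖ := by
      rw [h65071, show (1 + 240 * s3) * 65071 - 65071 = 240 * s3 * 65071 by ring, norm_mul, norm_mul, h65071]
      calc ‖(240 : ℚ_[3])‖ * ‖s3‖ * 1 ≤ 1 / 3 * (1 / 3) * 1 := by gcongr
        _ < 1 := by norm_num
    rw [Padic.norm_eq_of_norm_sub_lt_right hsub, h65071]
  have hD0 : (1 + 240 * s3) * 65071 ≠ 0 := by
    intro h; rw [h, norm_zero] at hD; exact zero_ne_one hD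
  rw [div_sub' hD0, norm_div, hD, div_one]
  have hnum : -(1 - 504 * s5) * -1439 - (1 + 240 * s3) * 65071 * 8 =
      -519129 + (-725256) * s5 + (-124936320) * s3 := by ring
  rw [hnum]
  have h1 : ‖(-519129 : ℚ_[3])‖ ≤ 1 / 9 := by
    rw [show (-519129 : ℚ_[3]) = ((-519129 : ℤ) : ℚ_[3]) by norm_cast]
    exact ((Padic.norm_int_le_pow_iff_dvd (p := 3) (-519129) 2).mpr (by norm_num)).trans (by norm_num)
  have h2' : ‖(-725256 : ℚ_[3]) * s5‖ ≤ 1 / 9 := by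
    rw [norm_mul, show (-725256 : ℚ_[3]) = ((-725256 : ℤ) : ℚ_[3]) by norm_cast]
    have h7 : ‖((-725256 : ℤ) : ℚ_[3])‖ ≤ 1 / 3 :=
      ((Padic.norm_int_le_pow_iff_dvd (p := 3) (-725256) 1).mpr (by norm_num)).trans (by norm_num)
    calc ‖((-725256 : ℤ) : ℚ_[3])‖ * ‖s5‖ ≤ 1 / 3 * (1 / 3) := by gcongr
      _ = 1 / 9 := by norm_num
  have h3 : ‖(-124936320 : ℚ_[3]) * s3‖ ≤ 1 / 9 := by
    rw [norm_mul, show (-124936320 : ℚ_[3]) = ((-124936320 : ℤ) : ℚ_[3]) by norm_cast]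
    have h7 : ‖((-124936320 : ℤ) : ℚ_[3])‖ ≤ 1 / 3 :=
      ((Padic.norm_int_le_pow_iff_dvd (p := 3) (-124936320) 1).mpr (by norm_num)).trans (by norm_num)
    calc ‖((-124936320 : ℤ) : ℚ_[3])‖ * ‖s3‖ ≤ 1 / 3 * (1 / 3) := by gcongr
      _ = 1 / 9 := by norm_num
  refine (IsUltrametricDist.norm_add_le_max _ _).trans (max_le ?_ h3)
  exact (IsUltrametricDist.norm_add_le_max _ _).trans (max_le h1 h2')

/-! ### §F The two Iwasawa logarithms to precision `O(3²)` -/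

/-- `‖(2 : ℚ₃)⁻¹‖ = 1`. [folklore] -/
private theorem norm_inv_two : ‖(2 : ℚ_[3])⁻¹‖ = 1 := by
  rw [norm_inv, show (2 : ℚ_[3]) = ((2 : ℕ) : ℚ_[3]) by norm_cast,
    norm_natCast_of_padicValNat (v := 0) (by norm_num) (padicValNat.eq_zero_of_not_dvd (by norm_num))]
  norm_num

/-- First-order evaluation of the Iwasawa series: for `‖1 − z‖ < 1`, `‖L(z) − (z − 1)‖ ≤ ‖1 − z‖²` in `ℚ₃`
(the tree's `norm_padicLogSeries_add_le` with `‖2⁻¹‖₃ = 1`). [cite: Iwasawa1972PadicL, §4.4] -/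
private theorem norm_padicLogSeries_sub_le {z : ℚ_[3]} (hz : ‖1 - z‖ < 1) :
    ‖padicLogSeries 3 z - (z - 1)‖ ≤ ‖1 - z‖ ^ 2 := by
  have h := norm_padicLogSeries_add_le (p := 3) hz
  rw [norm_inv_two, mul_one] at h
  have : padicLogSeries 3 z - (z - 1) = padicLogSeries 3 z + (1 - z) := by ring
  rwa [this]

/-- Unfolding `log₃` at an element of valuation `2`: `log₃ y = 2⁻¹ · L((y·3⁻²)²)`. [cite: Iwasawa1972PadicL, §4.4] -/
private theorem padicLog_of_norm_eq_ninth {y : ℚ_[3]} (hy : ‖y‖ = 1 / 9) :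
    padicLog 3 y = (2 : ℚ_[3])⁻¹ * padicLogSeries 3 ((y * (3 : ℚ_[3]) ^ (-(2 : ℤ))) ^ 2) := by
  have hy0 : y ≠ 0 := by
    intro h; rw [h, norm_zero] at hy; norm_num at hy
  have hv : y.valuation = 2 := valuation_eq_of_norm_eq hy0 (n := 2) (by rw [hy]; norm_num)
  rw [padicLog_of_ne_zero hy0, hv]
  norm_num

/-- **`‖log₃ 57600‖ ≤ 3⁻⁴`** (`den x(Q) = 57600 = 3²·6400`; `log₃ 57600 = 2⁻¹·L(6400²)` and `6400² ≡ 1 (mod 3⁴)`, so every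
term of the Iwasawa series has norm `≤ 3⁻⁴`). [cite: Iwasawa1972PadicL, §4.4] -/
theorem norm_padicLog_57600_le : ‖padicLog 3 (57600 : ℚ_[3])‖ ≤ 1 / 81 := by
  have hn : ‖(57600 : ℚ_[3])‖ = 1 / 9 := by
    rw [show (57600 : ℚ_[3]) = ((57600 : ℕ) : ℚ_[3]) by norm_cast,
      norm_natCast_of_padicValNat (v := 2) (by norm_num)
        (padicValNat_eq_of_dvd_of_not_dvd (by norm_num) (by norm_num) (by norm_num))]
    norm_num
  rw [padicLog_of_norm_eq_ninth hn]
  have hu : (57600 : ℚ_[3]) * (3 : ℚ_[3]) ^ (-(2 : ℤ)) = 6400 := by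
    rw [zpow_neg, zpow_two]; norm_num
  rw [hu]
  have ht : ‖1 - (6400 : ℚ_[3]) ^ 2‖ ≤ 1 / 81 := by
    have : (1 : ℚ_[3]) - 6400 ^ 2 = ((-40959999 : ℤ) : ℚ_[3]) := by push_cast; norm_num
    rw [this]
    have h := (Padic.norm_int_le_pow_iff_dvd (p := 3) (-40959999) 4).mpr (by norm_num)
    refine h.trans ?_
    norm_num
  have ht1 : ‖1 - (6400 : ℚ_[3]) ^ 2‖ < 1 := ht.trans_lt (by norm_num)
  have hL := norm_padicLogSeries_sub_le ht1
  have hL' : ‖padicLogSeries 3 ((6400 : ℚ_[3]) ^ 2)‖ ≤ 1 / 81 := by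
    calc ‖padicLogSeries 3 ((6400 : ℚ_[3]) ^ 2)‖
        = ‖(padicLogSeries 3 ((6400 : ℚ_[3]) ^ 2) - ((6400 : ℚ_[3]) ^ 2 - 1)) + ((6400 : ℚ_[3]) ^ 2 - 1)‖ := by
          ring_nf
      _ ≤ max ‖padicLogSeries 3 ((6400 : ℚ_[3]) ^ 2) - ((6400 : ℚ_[3]) ^ 2 - 1)‖ ‖(6400 : ℚ_[3]) ^ 2 - 1‖ :=
          IsUltrametricDist.norm_add_le_max _ _
      _ ≤ 1 / 81 := by
          refine max_le (hL.trans ?_) ?_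
          · calc ‖1 - (6400 : ℚ_[3]) ^ 2‖ ^ 2 ≤ (1 / 81) ^ 2 := by gcongr
              _ ≤ 1 / 81 := by norm_num
          · rw [← norm_neg, neg_sub]; exact ht
  rw [norm_mul, norm_inv_two, one_mul]
  exact hL'

/-- **`‖y − 144‖₃ ≤ 3⁻⁴ ⇒ ‖log₃ y − 6‖₃ ≤ 3⁻²`** (`u := y·3⁻²`, `‖u − 16‖ ≤ 3⁻²`, `‖L(u²) − (u² − 1)‖ ≤ 3⁻²`,
`log₃ y = 2⁻¹ L(u²)`, `255/2 − 6 = 3⁵/2`). [cite: Iwasawa1972PadicL, §4.4] -/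
theorem norm_padicLog_sub_six_le {y : ℚ_[3]} (hy : ‖y - 144‖ ≤ 1 / 81) : ‖padicLog 3 y - 6‖ ≤ 1 / 9 := by
  have h144 : ‖(144 : ℚ_[3])‖ = 1 / 9 := by
    rw [show (144 : ℚ_[3]) = ((144 : ℕ) : ℚ_[3]) by norm_cast,
      norm_natCast_of_padicValNat (v := 2) (by norm_num)
        (padicValNat_eq_of_dvd_of_not_dvd (by norm_num) (by norm_num) (by norm_num))]
    norm_num
  have hyn : ‖y‖ = 1 / 9 := by
    rw [← h144]
    exact Padic.norm_eq_of_norm_sub_lt_right (lt_of_le_of_lt hy (by rw [h144]; norm_num))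
  rw [padicLog_of_norm_eq_ninth hyn]
  set u : ℚ_[3] := y * (3 : ℚ_[3]) ^ (-(2 : ℤ)) with hu
  have hu16 : u - 16 = (y - 144) * (3 : ℚ_[3]) ^ (-(2 : ℤ)) := by
    rw [hu, zpow_neg, zpow_two]; field_simp; norm_num
  have h9 : ‖(3 : ℚ_[3]) ^ (-(2 : ℤ))‖ = 9 := by
    rw [show (3 : ℚ_[3]) = ((3 : ℕ) : ℚ_[3]) by norm_cast, Padic.norm_p_zpow]; norm_num
  have hun : ‖u - 16‖ ≤ 1 / 9 := by
    rw [hu16, norm_mul, h9]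
    calc ‖y - 144‖ * 9 ≤ 1 / 81 * 9 := by gcongr
      _ = 1 / 9 := by norm_num
  have hu1 : ‖u + 16‖ ≤ 1 := by
    have : u + 16 = (u - 16) + 32 := by ring
    rw [this]
    refine (IsUltrametricDist.norm_add_le_max _ _).trans (max_le (hun.trans (by norm_num)) ?_)
    rw [show (32 : ℚ_[3]) = ((32 : ℤ) : ℚ_[3]) by norm_cast]; exact Padic.norm_int_le_one _
  have husq : ‖u ^ 2 - 256‖ ≤ 1 / 9 := by
    have : u ^ 2 - 256 = (u - 16) * (u + 16) := by ring
    rw [this, norm_mul]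
    calc ‖u - 16‖ * ‖u + 16‖ ≤ 1 / 9 * 1 := by gcongr
      _ = 1 / 9 := by norm_num
  have h255 : ‖(255 : ℚ_[3])‖ ≤ 1 / 3 := by
    rw [show (255 : ℚ_[3]) = ((255 : ℤ) : ℚ_[3]) by norm_cast]
    exact ((Padic.norm_int_le_pow_iff_dvd (p := 3) 255 1).mpr (by norm_num)).trans (by norm_num)
  have h1u : ‖1 - u ^ 2‖ ≤ 1 / 3 := by
    have : 1 - u ^ 2 = -(u ^ 2 - 256) + (-255) := by ring
    rw [this]
    refine (IsUltrametricDist.norm_add_le_max _ _).trans (max_le ?_ ?_)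
    · rw [norm_neg]; exact husq.trans (by norm_num)
    · rw [norm_neg]; exact h255
  have h1u' : ‖1 - u ^ 2‖ < 1 := h1u.trans_lt (by norm_num)
  have hL := norm_padicLogSeries_sub_le h1u'
  have hsplit : (2 : ℚ_[3])⁻¹ * padicLogSeries 3 (u ^ 2) - 6 =
      (2 : ℚ_[3])⁻¹ * (padicLogSeries 3 (u ^ 2) - (u ^ 2 - 1)) + (2 : ℚ_[3])⁻¹ * (u ^ 2 - 256) +
        (2 : ℚ_[3])⁻¹ * 243 := by ring
  rw [hsplit]
  have h243 : ‖(2 : ℚ_[3])⁻¹ * 243‖ ≤ 1 / 9 := by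
    rw [norm_mul, norm_inv_two, one_mul, show (243 : ℚ_[3]) = ((243 : ℤ) : ℚ_[3]) by norm_cast]
    exact ((Padic.norm_int_le_pow_iff_dvd (p := 3) 243 2).mpr (by norm_num)).trans (by norm_num)
  refine (IsUltrametricDist.norm_add_le_max _ _).trans (max_le ?_ h243)
  refine (IsUltrametricDist.norm_add_le_max _ _).trans (max_le ?_ ?_)
  · rw [norm_mul, norm_inv_two, one_mul]
    refine hL.trans ?_
    calc ‖1 - u ^ 2‖ ^ 2 ≤ (1 / 3) ^ 2 := by gcongr
      _ = 1 / 9 := by norm_num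
  · rw [norm_mul, norm_inv_two, one_mul]; exact husq

/-! ### §G Assembly: `h = log₃(den x) − log₃(C²σ²) ≠ 0` from `C² ≡ 8 (mod 9)` and `σ² ≡ 18 (mod 81)` -/

/-- **`heightFourOneCoord W 3 q x y ≠ 0` from two `O(3²)` bounds.** For any curve `W/ℚ`, any `q ∈ ℚ₃` and any
coordinates with `den x = 57600`: if `C² = uniformisationScaleSq W 3 q` satisfies `‖C² − 8‖ ≤ 3⁻²` and
`σ² = tateSigmaSq q (coshOfSq (logUnitParamSq W 3 q x y))` satisfies `‖σ² − 18‖ ≤ 3⁻⁴`, then `y := C²σ² ≡ 144 (mod 3⁴)`,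
`‖log₃ y − 6‖ ≤ 3⁻²` (`norm_padicLog_sub_six_le`), `‖log₃(den x)‖ ≤ 3⁻⁴` (`norm_padicLog_57600_le`), so
`‖h + 6‖ ≤ 3⁻² < ‖6‖₃ = 3⁻¹` and `h ≠ 0`. For 62310y1's rung row the two bounds are exactly the residues `C² ≡ 8`,
`σ² ≡ 18` of FORMALISATION-SPEC §1 (targets of parts 2–3). [cite: SteinWuthrich2013, §4.2] -/
theorem heightFourOneCoord_ne_zero_of_norm_bounds (W : WeierstrassCurve ℚ) (q : ℚ_[3]) {x y : ℚ}
    (hx : x.den = 57600)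
    (hC : ‖uniformisationScaleSq W 3 q - 8‖ ≤ 1 / 9)
    (hS : ‖tateSigmaSq q (coshOfSq (logUnitParamSq W 3 q x y)) - 18‖ ≤ 1 / 81) :
    heightFourOneCoord W 3 q x y ≠ 0 := by
  set C2 := uniformisationScaleSq W 3 q with hC2
  set S2 := tateSigmaSq q (coshOfSq (logUnitParamSq W 3 q x y)) with hS2
  have hS' : ‖S2‖ ≤ 1 / 9 := by
    have h18 : ‖(18 : ℚ_[3])‖ ≤ 1 / 9 := by
      rw [show (18 : ℚ_[3]) = ((18 : ℤ) : ℚ_[3]) by norm_cast]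
      exact ((Padic.norm_int_le_pow_iff_dvd (p := 3) 18 2).mpr (by norm_num)).trans (by norm_num)
    have : S2 = (S2 - 18) + 18 := by ring
    rw [this]
    exact (IsUltrametricDist.norm_add_le_max _ _).trans (max_le (hS.trans (by norm_num)) h18)
  have hy : ‖C2 * S2 - 144‖ ≤ 1 / 81 := by
    have : C2 * S2 - 144 = (C2 - 8) * S2 + 8 * (S2 - 18) := by ring
    rw [this]
    refine (IsUltrametricDist.norm_add_le_max _ _).trans (max_le ?_ ?_)
    · rw [norm_mul]
      calc ‖C2 - 8‖ * ‖S2‖ ≤ 1 / 9 * (1 / 9) := by gcongr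
        _ = 1 / 81 := by norm_num
    · rw [norm_mul]
      have h8 : ‖(8 : ℚ_[3])‖ ≤ 1 := by
        rw [show (8 : ℚ_[3]) = ((8 : ℤ) : ℚ_[3]) by norm_cast]; exact Padic.norm_int_le_one _
      calc ‖(8 : ℚ_[3])‖ * ‖S2 - 18‖ ≤ 1 * (1 / 81) := by gcongr
        _ = 1 / 81 := by norm_num
  have hlog := norm_padicLog_sub_six_le hy
  have hden : padicLog 3 ((x.den : ℚ) : ℚ_[3]) = padicLog 3 (57600 : ℚ_[3]) := by
    rw [hx]; push_cast; rfl
  intro h0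
  have h0' : padicLog 3 (57600 : ℚ_[3]) - padicLog 3 (C2 * S2) = 0 := by
    rw [← hden]; exact h0
  have h6 : (6 : ℚ_[3]) = padicLog 3 (57600 : ℚ_[3]) - (padicLog 3 (C2 * S2) - 6) := by
    linear_combination (-1 : ℚ_[3]) * h0'
  have hn6 : ‖(6 : ℚ_[3])‖ ≤ 1 / 9 := by
    rw [h6]
    exact (norm_sub_le_max' _ _).trans (max_le (norm_padicLog_57600_le.trans (by norm_num)) hlog)
  have h6' : ‖(6 : ℚ_[3])‖ = 1 / 3 := by
    rw [show (6 : ℚ_[3]) = ((6 : ℕ) : ℚ_[3]) by norm_cast,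
      norm_natCast_of_padicValNat (v := 1) (by norm_num)
        (padicValNat_eq_of_dvd_of_not_dvd (by norm_num) (by norm_num) (by norm_num))]
    norm_num
  rw [h6'] at hn6
  norm_num at hn6

end Summit.BirchSwinnertonDyer.Rank1Residual.X11b.RegMult.Rung62310y1
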